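import Summits.Ventures.PercRepro.S1SpreadTriDegree

/-!
# PercRepro — THREE TRIANGLES AVOIDING ANY GIVEN TRIANGLE WHEN THERE ARE `≥ 6` (regime B) (p1, gen 36)

`proofs/P1-S2-CORANK6.md` §4t. Since a triangle meets at most two others (`ncard_triangles_meeting_le_two`), with `t ≥ 6`
triangles every triangle `T` has at least `t − 3 ≥ 3` triangles disjoint from it, pairwise distinct
(**`exists_three_disjoint_triangles_of_six`**, `…_of_free` in the `hfree` / `hns` vocabulary): the hypothesis of p7's
three-avoiding-triangles charge of the top `6`-sets through `T` (the case (a) of the rows `t ≥ 9`) at every row `t ≥ 6`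
of the spread case. Nothing about any cell is claimed. Axioms: standard.
-/

open scoped Matroid

namespace PercRepro

namespace S1

open Set

variable {α : Type}

/-- **With `≥ 6` triangles, every triangle has three distinct triangles disjoint from it** (regime B). -/
theorem exists_three_disjoint_triangles_of_six (M : Matroid α) [M.Finite]
    (hC1 : ∀ L ⊆ M.E, M.eRk L = 2 → L.ncard ≤ 3)
    (h9 : ∀ X ⊆ M.E, X.ncard ≤ 9 → X.encard ≤ M.eRk X + 3)
    (hno : ¬ ∃ W ⊆ M.E, W.ncard = 6 ∧ M.eRk W ≤ 3)
    (h6 : 6 ≤ {C : Set α | M.IsCircuit C ∧ C.ncard = 3}.ncard)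
    {T : Set α} (hT : M.IsCircuit T) (hT3 : T.ncard = 3) :
    ∃ D₁ D₂ D₃ : Set α, M.IsCircuit D₁ ∧ D₁.ncard = 3 ∧ M.IsCircuit D₂ ∧ D₂.ncard = 3 ∧
      M.IsCircuit D₃ ∧ D₃.ncard = 3 ∧ D₁ ≠ D₂ ∧ D₁ ≠ D₃ ∧ D₂ ≠ D₃ ∧
      Disjoint D₁ T ∧ Disjoint D₂ T ∧ Disjoint D₃ T := by
  have h𝒟fin : {C : Set α | M.IsCircuit C ∧ C.ncard = 3 ∧ Disjoint C T}.Finite :=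
    M.ground_finite.finite_subsets.subset (fun C hC => hC.1.subset_ground)
  have h3 := ncard_triangles_le_three_add_disjoint M hC1 h9 hno hT hT3
  have h2 : 2 < {C : Set α | M.IsCircuit C ∧ C.ncard = 3 ∧ Disjoint C T}.ncard := by omega
  obtain ⟨D₁, D₂, D₃, hD₁, hD₂, hD₃, h12, h13, h23⟩ := (Set.two_lt_ncard_iff h𝒟fin).1 h2
  exact ⟨D₁, D₂, D₃, hD₁.1, hD₁.2.1, hD₂.1, hD₂.2.1, hD₃.1, hD₃.2.1, h12, h13, h23, hD₁.2.2, hD₂.2.2, hD₃.2.2⟩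

/-- **Three distinct triangles avoiding `T`** on a spread e-free core with `≥ 6` triangles. -/
theorem exists_three_disjoint_triangles_of_free (M : Matroid α) [M.Finite]
    (hfree : ∀ e ∈ M.E, ∃ A ⊆ M.E \ {e}, e ∉ M.closure A ∧ e ∉ M.closure ((M.E \ {e}) \ A))
    (hns : ¬ ∃ W ⊆ M.E, W.ncard ≤ 9 ∧ W.encard = M.eRk W + 4)
    (h6 : 6 ≤ {C : Set α | M.IsCircuit C ∧ C.ncard = 3}.ncard)
    {T : Set α} (hT : M.IsCircuit T) (hT3 : T.ncard = 3) :
    ∃ D₁ D₂ D₃ : Set α, M.IsCircuit D₁ ∧ D₁.ncard = 3 ∧ M.IsCircuit D₂ ∧ D₂.ncard = 3 ∧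
      M.IsCircuit D₃ ∧ D₃.ncard = 3 ∧ D₁ ≠ D₂ ∧ D₁ ≠ D₃ ∧ D₂ ≠ D₃ ∧
      Disjoint D₁ T ∧ Disjoint D₂ T ∧ Disjoint D₃ T :=
  exists_three_disjoint_triangles_of_six M (lines_le_three_of_free M hfree) (nullity_le_three_of_spread M hns)
    (no_six_of_five_le_triangles M hfree hns (by omega)) h6 hT hT3

/-- **`t − 3 ≤ #{triangles disjoint from T}`** in regime B. -/
theorem sub_three_le_ncard_disjoint_triangles (M : Matroid α) [M.Finite]
    (hC1 : ∀ L ⊆ M.E, M.eRk L = 2 → L.ncard ≤ 3)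
    (h9 : ∀ X ⊆ M.E, X.ncard ≤ 9 → X.encard ≤ M.eRk X + 3)
    (hno : ¬ ∃ W ⊆ M.E, W.ncard = 6 ∧ M.eRk W ≤ 3)
    {T : Set α} (hT : M.IsCircuit T) (hT3 : T.ncard = 3) :
    {C : Set α | M.IsCircuit C ∧ C.ncard = 3}.ncard - 3 ≤
      {C : Set α | M.IsCircuit C ∧ C.ncard = 3 ∧ Disjoint C T}.ncard := by
  have := ncard_triangles_le_three_add_disjoint M hC1 h9 hno hT hT3
  omega

end S1

end PercRepro
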